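import Summits.CriticalPhenomena.PercolationContinuityZ3.Theorems.PercFiniteBoxLROCerf2015BoxLRO16Decay
import Literature.Probability.Percolation.CriticalContinuityProofs
import HarnessLib

/-!
# Crux `PercShatteringRace.NearLinearTwoClusterDecay` (stmt-CriticalPhenomena-5785) — frontier stub W2
# `stub_critTwoArmImproved`, auxiliary file: Cerf's §8 inequality WITHOUT `θ(p) > 0`

Helper file of the line `pair-decay-long-arms-dense`; lands with `--supports stmt-CriticalPhenomena-5785`
(registered stub `stub_critTwoArmImproved`, bond Cerf 2015 Theorem 1.1 at `p_c(ℤ³)`).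

The tree's bond transcription of Cerf 2015, §8–§9 (`Cerf2015BoxLRO16.cube_mul_real_edgeTwoArms_le`,
`Cerf2015BoxLRO16.real_edgeTwoArms_dyadic_le`) assumes `θ(p) > 0`, and uses it ONLY through the box
two-arms sum `Cerf2015BoxLRO16.sum_real_twoArmsBox_three_le`, whose `θ` comes from the `θ`-based
pair-connection lower bound of §10.  Here the pair-connection lower bound is an explicit HYPOTHESIS
`P_p(a ↔ b inside Λ_{2n}) ≥ c n^{-12}` for `a, b ∈ Λ_n`, `n ≥ 1` (the W1 input of the line, available
unconditionally at `p = p_c(ℤ³)`), and we re-derive: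

* `sum_real_twoArmsBox_le_of_conn`: Cor. 7.2-type sum from Lemma 7.1 (`AKN.real_twoArmsBox_mul_le`)
  divided by a pair-connection lower bound `δ` on `Λ_k²` inside `Λ_{2k}` (general `d`);
* `sum_real_twoArmsBox_three_le_crit`: its `d = 3` polynomial form
  `Σ_{z,z'∈Λ_k} P_p(twoArmsBox k ℓ z z') ≤ (3⁶ 7⁷/(p c)) k^{24} τ(ℓ−k−2)`;
* `cube_mul_real_edgeTwoArms_le_crit`: Cerf's §8 inequality in polynomial form,
  `n³ P_p(edgeTwoArms i (3n)) ≤ t n^{3/2} j (189 + A k^{27} τ(n−k−2)) + (144/p)(2n+1)^9 e^{−2p²(1−p)²t²}`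
  (proof = `Cerf2015BoxLRO16.cube_mul_real_edgeTwoArms_le` verbatim, with the new box sum).

This file introduces no definition.

## References

* R. Cerf, *A lower bound on the two-arms exponent for critical percolation on the lattice*, Ann.
  Probab. 43 (2015) 2458–2480, arXiv:1306.3105, §7–§8 [Cerf2015].
-/

noncomputable section

namespace Summit.CriticalPhenomena.PercolationContinuityZ3.Theorems

open Literature.Probability.Percolation Literature.Probability.Percolation.AKN
  Literature.Probability.Percolation.GM Literature.Probability.LatticeModels MeasureTheory Finset Real
open scoped Classical
open Cerf2015BoxLRO16

namespace NearLinearTwoClusterDecayCritTwoArm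

variable {d : ℕ}

/-- **Cerf 2015, Cor. 7.2-type sum with Lemma 7.1 divided by a pair-connection lower bound** (bond
version, general `d`): for `0 < p`, `k + 3 ≤ ℓ` and `δ > 0` with `δ ≤ P_p(a ↔ b inside Λ_{2k})` for all
`a, b ∈ Λ_k`,
`Σ_{z,z' ∈ Λ_k} P_p(twoArmsBox k ℓ z z') ≤ |Λ_k|² (1 + |E(Λ_{2k+1})|/p) |Λ_{2k+1}| τ(ℓ−k−2) / δ`,
`τ(m) = Σ_i P_p(edgeTwoArms i m)` (adapted from `Cerf2015BoxLRO16.sum_real_twoArmsBox_le`, the `θ`-based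
lower bound replaced by `δ`). [cite: Cerf2015, Lemma 7.1 and Cor 7.2] -/
theorem sum_real_twoArmsBox_le_of_conn (p : unitInterval) (hp0 : 0 < (p : ℝ)) {k ℓ : ℕ}
    (hℓ : k + 3 ≤ ℓ) {δ : ℝ} (hδ : 0 < δ)
    (hq : ∀ a ∈ box d k, ∀ b ∈ box d k,
      δ ≤ (bondPercolation (zdGraph d) p).real (openConnIn (↑(box d (k + k)) : Set (Site d)) a b)) :
    ∑ z ∈ box d k, ∑ z' ∈ box d k, (bondPercolation (zdGraph d) p).real (twoArmsBox k ℓ z z') ≤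
      ((box d k).card : ℝ) ^ 2 *
        ((1 + (edgesIn (zdGraph d) (box d (k + k + 1))).card / p) *
          ((box d (k + k + 1)).card *
            ∑ i : Fin d, (bondPercolation (zdGraph d) p).real (edgeTwoArms i (ℓ - k - 2)))) / δ := by
  set μ := bondPercolation (zdGraph d) p with hμ
  obtain ⟨Rf, hRf⟩ : ∃ Rf : ℝ, Rf = (1 + (edgesIn (zdGraph d) (box d (k + k + 1))).card / p) *
      ((box d (k + k + 1)).card * ∑ i : Fin d, μ.real (edgeTwoArms i (ℓ - k - 2))) := ⟨_, rfl⟩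
  rw [← hRf]
  -- `openConnIn` (hypothesis) versus `openConnVia (withinGraph ℤ^d ·)` (Lemma 7.1), a.s. comparable
  have hvia : ∀ a ∈ box d k, ∀ b ∈ box d k,
      δ ≤ μ.real (openConnVia (withinGraph (zdGraph d) (↑(box d (k + k)) : Set (Site d))) a b) := by
    intro a ha b hb
    refine (hq a ha b hb).trans
      (DCT16.real_mono_of_forall_subset_edgeSet (zdGraph d) p fun ω hω h => ?_)
    have ha' : a ∈ (↑(box d (k + k)) : Set (Site d)) :=
      Finset.mem_coe.2 (box_mono d (Nat.le_add_right k k) ha)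
    rw [openConnIn_eq_openConnVia ha'] at h
    rw [openConnVia, Set.mem_setOf_eq, openClusterIn_withinGraph_eq_top (zdGraph d) _ hω]
    exact h
  have hpair : ∀ a ∈ box d k, ∀ b ∈ box d k, μ.real (twoArmsBox k ℓ a b) ≤ Rf / δ := by
    intro a ha b hb
    have h71 := real_twoArmsBox_mul_le p hp0 (n := k) (k := k) hℓ ha hb
    rw [← hRf] at h71
    rw [le_div_iff₀ hδ]
    calc μ.real (twoArmsBox k ℓ a b) * δ ≤ μ.real (twoArmsBox k ℓ a b) *
          μ.real (openConnVia (withinGraph (zdGraph d) ↑(box d (k + k))) a b) :=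
          mul_le_mul_of_nonneg_left (hvia a ha b hb) measureReal_nonneg
      _ ≤ Rf := h71
  calc ∑ z ∈ box d k, ∑ z' ∈ box d k, μ.real (twoArmsBox k ℓ z z')
      ≤ ∑ _z ∈ box d k, ∑ _z' ∈ box d k, Rf / δ :=
        Finset.sum_le_sum fun a ha => Finset.sum_le_sum fun b hb => hpair a ha b hb
    _ = ((box d k).card : ℝ) ^ 2 * Rf / δ := by
        rw [Finset.sum_const, Finset.sum_const, nsmul_eq_mul, nsmul_eq_mul]; ring

/-- **The box two-arms sum on `ℤ³` from a polynomial pair-connection lower bound, polynomial form**: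
if `P_p(a ↔ b inside Λ_{2n}) ≥ c n^{-12}` for all `a, b ∈ Λ_n`, `n ≥ 1` (`c > 0`), then for `0 < p`,
`k ≥ 1`, `ℓ ≥ k + 3`,
`Σ_{z,z' ∈ Λ_k} P_p(twoArmsBox k ℓ z z') ≤ (3⁶ 7⁷/(p c)) k^{24} τ(ℓ−k−2)`
(`|Λ_k|² ≤ 3⁶ k⁶`, `(1 + |E(Λ_{2k+1})|/p) |Λ_{2k+1}| ≤ 7⁷ k⁶/p`, `1/(c k^{-12}) = k^{12}/c`; adapted from
`Cerf2015BoxLRO16.sum_real_twoArmsBox_three_le`). [cite: Cerf2015, Cor 7.2] -/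
theorem sum_real_twoArmsBox_three_le_crit (p : unitInterval) (hp0 : 0 < (p : ℝ)) {c : ℝ} (hc : 0 < c)
    (hW : ∀ n : ℕ, 1 ≤ n → ∀ a ∈ box 3 n, ∀ b ∈ box 3 n,
      c * (n : ℝ) ^ (-(12 : ℝ)) ≤
        (bondPercolation (zdGraph 3) p).real (openConnIn (↑(box 3 (2 * n)) : Set (Site 3)) a b))
    {k ℓ : ℕ} (hk : 1 ≤ k) (hℓ : k + 3 ≤ ℓ) :
    ∑ z ∈ box 3 k, ∑ z' ∈ box 3 k, (bondPercolation (zdGraph 3) p).real (twoArmsBox k ℓ z z') ≤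
      (3 : ℝ) ^ 6 * 7 ^ 7 / ((p : ℝ) * c) * (k : ℝ) ^ 24 *
        ∑ i : Fin 3, (bondPercolation (zdGraph 3) p).real (edgeTwoArms i (ℓ - k - 2)) := by
  obtain ⟨T, hT⟩ : ∃ T : ℝ, T = ∑ i : Fin 3,
      (bondPercolation (zdGraph 3) p).real (edgeTwoArms i (ℓ - k - 2)) := ⟨_, rfl⟩
  have hT0 : 0 ≤ T := by rw [hT]; exact Finset.sum_nonneg fun _ _ => measureReal_nonneg
  have hk0 : (0 : ℝ) < k := by exact_mod_cast hk
  have hk1 : (1 : ℝ) ≤ k := by exact_mod_cast hk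
  -- the pair-connection lower bound `δ = c k^{-12} = c / k^12` on `Λ_k²` inside `Λ_{2k} = Λ_{k+k}`
  have hrpow : (k : ℝ) ^ (-(12 : ℝ)) = ((k : ℝ) ^ 12)⁻¹ := by
    rw [Real.rpow_neg hk0.le, show (12 : ℝ) = ((12 : ℕ) : ℝ) by norm_num, Real.rpow_natCast]
  have hδ : 0 < c * ((k : ℝ) ^ 12)⁻¹ := by positivity
  have hq : ∀ a ∈ box 3 k, ∀ b ∈ box 3 k, c * ((k : ℝ) ^ 12)⁻¹ ≤
      (bondPercolation (zdGraph 3) p).real (openConnIn (↑(box 3 (k + k)) : Set (Site 3)) a b) := by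
    intro a ha b hb
    have h := hW k hk a ha b hb
    rwa [two_mul, hrpow] at h
  have h3 := sum_real_twoArmsBox_le_of_conn (d := 3) p hp0 hℓ hδ hq
  rw [← hT] at h3 ⊢
  have h23 : (2 * (k : ℝ) + 1) ≤ 3 * (k : ℝ) := by linarith
  -- the two counting factors
  have ha : ((box 3 k).card : ℝ) ^ 2 ≤ 729 * (k : ℝ) ^ 6 := by
    rw [card_box]; push_cast
    calc ((2 * (k : ℝ) + 1) ^ 3) ^ 2 = (2 * (k : ℝ) + 1) ^ 6 := by ring
      _ ≤ (3 * (k : ℝ)) ^ 6 := pow_le_pow_left₀ (by linarith) h23 6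
      _ = 729 * (k : ℝ) ^ 6 := by ring
  have hE2 := card_edgesIn_box_three_le (k + k + 1)
  push_cast at hE2
  have hY : (2 * ((k : ℝ) + k + 1) + 1) ≤ 7 * (k : ℝ) := by linarith
  have hY3 : (2 * ((k : ℝ) + k + 1) + 1) ^ 3 ≤ (7 * (k : ℝ)) ^ 3 := pow_le_pow_left₀ (by linarith) hY 3
  have h7k : (1 : ℝ) ≤ (7 * (k : ℝ)) ^ 3 := one_le_pow₀ (by linarith)
  have hp1 : (p : ℝ) ≤ 1 := p.2.2
  have hb : (1 + ((edgesIn (zdGraph 3) (box 3 (k + k + 1))).card : ℝ) / (p : ℝ)) *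
      ((box 3 (k + k + 1)).card : ℝ) ≤ 7 ^ 7 * (k : ℝ) ^ 6 / p := by
    rw [card_box]
    push_cast
    have h1 : 1 + ((edgesIn (zdGraph 3) (box 3 (k + k + 1))).card : ℝ) / p ≤ 7 * (7 * (k : ℝ)) ^ 3 / p := by
      rw [add_div' _ _ _ hp0.ne', div_le_div_iff_of_pos_right hp0]
      nlinarith
    calc (1 + ((edgesIn (zdGraph 3) (box 3 (k + k + 1))).card : ℝ) / p) * (2 * ((k : ℝ) + k + 1) + 1) ^ 3
        ≤ (7 * (7 * (k : ℝ)) ^ 3 / p) * (7 * (k : ℝ)) ^ 3 :=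
          mul_le_mul h1 hY3 (pow_nonneg (by linarith) 3) (div_nonneg (by positivity) hp0.le)
      _ = 7 ^ 7 * (k : ℝ) ^ 6 / p := by ring
  -- the numerator
  have hnum0 : 0 ≤ (729 * (k : ℝ) ^ 6) * (7 ^ 7 * (k : ℝ) ^ 6 / p * T) :=
    mul_nonneg (by positivity) (mul_nonneg (div_nonneg (by positivity) hp0.le) hT0)
  have hnum : ((box 3 k).card : ℝ) ^ 2 *
      ((1 + ((edgesIn (zdGraph 3) (box 3 (k + k + 1))).card : ℝ) / (p : ℝ)) *
        (((box 3 (k + k + 1)).card : ℝ) * T)) ≤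
      (729 * (k : ℝ) ^ 6) * (7 ^ 7 * (k : ℝ) ^ 6 / p * T) := by
    have hmid : (1 + ((edgesIn (zdGraph 3) (box 3 (k + k + 1))).card : ℝ) / (p : ℝ)) *
        (((box 3 (k + k + 1)).card : ℝ) * T) ≤ 7 ^ 7 * (k : ℝ) ^ 6 / p * T := by
      rw [← mul_assoc]
      exact mul_le_mul_of_nonneg_right hb hT0
    have hmid0 : 0 ≤ (1 + ((edgesIn (zdGraph 3) (box 3 (k + k + 1))).card : ℝ) / (p : ℝ)) *
        (((box 3 (k + k + 1)).card : ℝ) * T) :=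
      mul_nonneg (add_nonneg zero_le_one (div_nonneg (Nat.cast_nonneg _) hp0.le))
        (mul_nonneg (Nat.cast_nonneg _) hT0)
    exact mul_le_mul ha hmid hmid0 (by positivity)
  calc _ ≤ _ := h3
    _ ≤ (729 * (k : ℝ) ^ 6) * (7 ^ 7 * (k : ℝ) ^ 6 / p * T) / (c * ((k : ℝ) ^ 12)⁻¹) :=
        div_le_div_of_nonneg_right hnum hδ.le
    _ = (3 : ℝ) ^ 6 * 7 ^ 7 / ((p : ℝ) * c) * (k : ℝ) ^ 24 * T := by
        field_simp
        ring

end NearLinearTwoClusterDecayCritTwoArm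

open NearLinearTwoClusterDecayCritTwoArm in
/-- **Cerf 2015, §8, last display, bond version on `ℤ³` in polynomial form, from a polynomial
pair-connection lower bound in place of `θ(p) > 0`**: for `0 < p < 1` and `c > 0` with
`P_p(a ↔ b inside Λ_{2n}) ≥ c n^{-12}` on `Λ_n²` (`n ≥ 1`) there is `A ≥ 0` such that for all
`k, j ≥ 1`, `n = (2k+1)j + k ≥ k + 3`, `t ≥ 0` and every direction `i`,
`n³ P_p(edgeTwoArms i (3n)) ≤ t n^{3/2} j (189 + A k^{27} τ(n−k−2)) + (144/p) (2n+1)^9 e^{−2p²(1−p)²t²}`,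
`τ(m) = Σ_i P_p(edgeTwoArms i m)` (proof = `Cerf2015BoxLRO16.cube_mul_real_edgeTwoArms_le`, the box
two-arms sum now `sum_real_twoArmsBox_three_le_crit`). [cite: Cerf2015, §8] -/
theorem cube_mul_real_edgeTwoArms_le_crit (p : unitInterval) (hp0 : 0 < (p : ℝ)) (hp1 : (p : ℝ) < 1)
    {c : ℝ} (hc : 0 < c)
    (hW : ∀ n : ℕ, 1 ≤ n → ∀ a ∈ box 3 n, ∀ b ∈ box 3 n,
      c * (n : ℝ) ^ (-(12 : ℝ)) ≤
        (bondPercolation (zdGraph 3) p).real (openConnIn (↑(box 3 (2 * n)) : Set (Site 3)) a b)) :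
    ∃ A : ℝ, 0 ≤ A ∧ ∀ (i : Fin 3) (k j n : ℕ), 1 ≤ k → 1 ≤ j → n = (2 * k + 1) * j + k → k + 3 ≤ n →
      ∀ t : ℝ, 0 ≤ t →
        (n : ℝ) ^ 3 * (bondPercolation (zdGraph 3) p).real (edgeTwoArms i (3 * n)) ≤
          t * Real.sqrt ((n : ℝ) ^ 3) * j *
              (189 + A * (k : ℝ) ^ 27 *
                ∑ i' : Fin 3, (bondPercolation (zdGraph 3) p).real (edgeTwoArms i' (n - k - 2))) +
            144 / p * (2 * (n : ℝ) + 1) ^ 9 * Real.exp (-2 * (p : ℝ) ^ 2 * (1 - p) ^ 2 * t ^ 2) := by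
  obtain ⟨K₂, hK₂⟩ : ∃ K₂ : ℝ, K₂ = (3 : ℝ) ^ 6 * 7 ^ 7 / ((p : ℝ) * c) := ⟨_, rfl⟩
  have hK₂0 : 0 ≤ K₂ := by rw [hK₂]; positivity
  refine ⟨4374 * K₂, by positivity, ?_⟩
  intro i k j n hk hj hn hkn t ht
  have hn1 : 1 ≤ n := by omega
  have hk0 : (0 : ℝ) < k := by exact_mod_cast hk
  have hj0 : (0 : ℝ) < j := by exact_mod_cast hj
  have hn0 : (0 : ℝ) < n := by exact_mod_cast hn1
  have hk1 : (1 : ℝ) ≤ k := by exact_mod_cast hk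
  have hj1 : (1 : ℝ) ≤ j := by exact_mod_cast hj
  -- the sum of the statistics `T` and the box two-arms sum `S`
  obtain ⟨T, hT⟩ : ∃ T : ℝ, T = ∑ i' : Fin 3,
      (bondPercolation (zdGraph 3) p).real (edgeTwoArms i' (n - k - 2)) := ⟨_, rfl⟩
  have hT0 : 0 ≤ T := by rw [hT]; exact Finset.sum_nonneg fun _ _ => measureReal_nonneg
  obtain ⟨S, hS⟩ : ∃ S : ℝ, S = ∑ z ∈ box 3 k, ∑ z' ∈ box 3 k,
      (bondPercolation (zdGraph 3) p).real (twoArmsBox k n z z') := ⟨_, rfl⟩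
  have hS0 : 0 ≤ S := by
    rw [hS]; exact Finset.sum_nonneg fun _ _ => Finset.sum_nonneg fun _ _ => measureReal_nonneg
  rw [← hT]
  -- Step A's inequality with `M = 2j + 1`, `ℓ = n`
  have hM : (0 : ℝ) < 2 * (j : ℝ) + 1 := by linarith
  have hcov := card_mul_real_edgeTwoArms_le_cover (d := 3) p hp0 hp1 i hn hn1 hn1 ht hM
  rw [show 2 * n + n = 3 * n by ring, ← hS] at hcov
  -- (i) the left-hand side
  have hL : (n : ℝ) ^ 3 * (bondPercolation (zdGraph 3) p).real (edgeTwoArms i (3 * n)) ≤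
      ((box 3 (n - 1)).card : ℝ) * (bondPercolation (zdGraph 3) p).real (edgeTwoArms i (3 * n)) := by
    refine mul_le_mul_of_nonneg_right ?_ measureReal_nonneg
    rw [card_box]
    have h2 : (n : ℝ) ≤ ((2 * (n - 1) + 1 : ℕ) : ℝ) := by
      have : n ≤ 2 * (n - 1) + 1 := by omega
      exact_mod_cast this
    calc (n : ℝ) ^ 3 ≤ ((2 * (n - 1) + 1 : ℕ) : ℝ) ^ 3 := pow_le_pow_left₀ hn0.le h2 3
      _ = (((2 * (n - 1) + 1) ^ 3 : ℕ) : ℝ) := by push_cast; ring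
  -- (ii) `√(2|E(Λ_n)|) ≤ 18 n^{3/2}`
  have hE := card_edgesIn_box_three_le n
  have hX3 : (2 * (n : ℝ) + 1) ≤ 3 * n := by linarith [show (1 : ℝ) ≤ n by exact_mod_cast hn1]
  have hX0 : (0 : ℝ) ≤ 2 * (n : ℝ) + 1 := by linarith
  have hn3 : (0 : ℝ) ≤ (n : ℝ) ^ 3 := by positivity
  have hsqE : Real.sqrt (2 * (edgesIn (zdGraph 3) (box 3 n)).card) ≤ 18 * Real.sqrt ((n : ℝ) ^ 3) := by
    have h1 : (2 : ℝ) * (edgesIn (zdGraph 3) (box 3 n)).card ≤ 18 ^ 2 * (n : ℝ) ^ 3 := by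
      have : (2 * (n : ℝ) + 1) ^ 3 ≤ (3 * (n : ℝ)) ^ 3 := pow_le_pow_left₀ hX0 hX3 3
      nlinarith
    calc Real.sqrt (2 * (edgesIn (zdGraph 3) (box 3 n)).card)
        ≤ Real.sqrt (18 ^ 2 * (n : ℝ) ^ 3) := Real.sqrt_le_sqrt h1
      _ = 18 * Real.sqrt ((n : ℝ) ^ 3) := by rw [Real.sqrt_mul (by norm_num), Real.sqrt_sq (by norm_num)]
  -- (iii) the box two-arms sum, from the pair-connection lower bound
  have hSle : S ≤ K₂ * (k : ℝ) ^ 24 * T := by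
    have h := sum_real_twoArmsBox_three_le_crit p hp0 hc hW hk hkn
    rwa [← hS, ← hT, ← hK₂] at h
  -- (iv) the bracket
  have hBj := card_innerBoundary_box_three_le j
  have hc3S : (2 * (k : ℝ) + 1) ^ 3 * S ≤ 27 * K₂ * (k : ℝ) ^ 27 * T := by
    have hc : (2 * (k : ℝ) + 1) ^ 3 ≤ 27 * (k : ℝ) ^ 3 := by
      have h23 : (2 * (k : ℝ) + 1) ≤ 3 * (k : ℝ) := by linarith
      calc (2 * (k : ℝ) + 1) ^ 3 ≤ (3 * (k : ℝ)) ^ 3 := pow_le_pow_left₀ (by linarith) h23 3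
        _ = 27 * (k : ℝ) ^ 3 := by ring
    have hKT : 0 ≤ K₂ * (k : ℝ) ^ 24 * T := mul_nonneg (mul_nonneg hK₂0 (by positivity)) hT0
    calc (2 * (k : ℝ) + 1) ^ 3 * S ≤ (27 * (k : ℝ) ^ 3) * (K₂ * (k : ℝ) ^ 24 * T) :=
          mul_le_mul hc hSle hS0 (by positivity)
      _ = 27 * K₂ * (k : ℝ) ^ 27 * T := by ring
  have hKT27 : 0 ≤ K₂ * (k : ℝ) ^ 27 * T := mul_nonneg (mul_nonneg hK₂0 (by positivity)) hT0
  have hW0 : 0 ≤ 7 / 2 + 81 * K₂ * (k : ℝ) ^ 27 * T := by nlinarith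
  have hbr : ((innerBoundary (zdGraph 3) (box 3 j)).card : ℝ) * (1 + (2 * (k : ℝ) + 1) ^ 3 * S) /
        (2 * (2 * (j : ℝ) + 1)) + (2 * (j : ℝ) + 1) / 2 ≤
      3 * j * (7 / 2 + 81 * K₂ * (k : ℝ) ^ 27 * T) := by
    have h1 : ((innerBoundary (zdGraph 3) (box 3 j)).card : ℝ) * (1 + (2 * (k : ℝ) + 1) ^ 3 * S) /
        (2 * (2 * (j : ℝ) + 1)) ≤ 3 * (2 * (j : ℝ) + 1) * (1 + 27 * K₂ * (k : ℝ) ^ 27 * T) := by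
      rw [div_le_iff₀ (by linarith)]
      have hS1 : 0 ≤ 1 + (2 * (k : ℝ) + 1) ^ 3 * S := by positivity
      calc ((innerBoundary (zdGraph 3) (box 3 j)).card : ℝ) * (1 + (2 * (k : ℝ) + 1) ^ 3 * S)
          ≤ (6 * (2 * (j : ℝ) + 1) ^ 2) * (1 + 27 * K₂ * (k : ℝ) ^ 27 * T) :=
            mul_le_mul hBj (by linarith) hS1 (by positivity)
        _ = 3 * (2 * (j : ℝ) + 1) * (1 + 27 * K₂ * (k : ℝ) ^ 27 * T) * (2 * (2 * (j : ℝ) + 1)) := by ring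
    have h2 : (2 * (j : ℝ) + 1) ≤ 3 * j := by linarith
    calc _ ≤ 3 * (2 * (j : ℝ) + 1) * (1 + 27 * K₂ * (k : ℝ) ^ 27 * T) + (2 * (j : ℝ) + 1) / 2 :=
          add_le_add h1 le_rfl
      _ = (2 * (j : ℝ) + 1) * (7 / 2 + 81 * K₂ * (k : ℝ) ^ 27 * T) := by ring
      _ ≤ (3 * j) * (7 / 2 + 81 * K₂ * (k : ℝ) ^ 27 * T) := mul_le_mul_of_nonneg_right h2 hW0
      _ = _ := by ring
  -- (v) the junk term
  have hJ : 2 * ((edgesIn (zdGraph 3) (box 3 n)).card : ℝ) / p *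
      (2 * ((box 3 n).card : ℝ) * (edgesIn (zdGraph 3) (box 3 n)).card *
        Real.exp (-2 * (p : ℝ) ^ 2 * (1 - p) ^ 2 * t ^ 2)) ≤
      144 / p * (2 * (n : ℝ) + 1) ^ 9 * Real.exp (-2 * (p : ℝ) ^ 2 * (1 - p) ^ 2 * t ^ 2) := by
    rw [card_box]
    push_cast
    have he0 : 0 ≤ Real.exp (-2 * (p : ℝ) ^ 2 * (1 - p) ^ 2 * t ^ 2) := (Real.exp_pos _).le
    have hE0 : 0 ≤ ((edgesIn (zdGraph 3) (box 3 n)).card : ℝ) := Nat.cast_nonneg _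
    have h1 : 2 * ((edgesIn (zdGraph 3) (box 3 n)).card : ℝ) / p *
        (2 * (2 * (n : ℝ) + 1) ^ 3 * (edgesIn (zdGraph 3) (box 3 n)).card) ≤
        144 / p * (2 * (n : ℝ) + 1) ^ 9 := by
      rw [div_mul_eq_mul_div, div_mul_eq_mul_div, div_le_div_iff_of_pos_right hp0]
      have hX30 : 0 ≤ (2 * (n : ℝ) + 1) ^ 3 := pow_nonneg hX0 3
      calc 2 * ((edgesIn (zdGraph 3) (box 3 n)).card : ℝ) *
            (2 * (2 * (n : ℝ) + 1) ^ 3 * (edgesIn (zdGraph 3) (box 3 n)).card)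
          = 4 * (2 * (n : ℝ) + 1) ^ 3 *
              (((edgesIn (zdGraph 3) (box 3 n)).card : ℝ) * (edgesIn (zdGraph 3) (box 3 n)).card) := by ring
        _ ≤ 4 * (2 * (n : ℝ) + 1) ^ 3 * ((6 * (2 * (n : ℝ) + 1) ^ 3) * (6 * (2 * (n : ℝ) + 1) ^ 3)) :=
            mul_le_mul_of_nonneg_left (mul_le_mul hE hE hE0 (by positivity)) (by positivity)
        _ = 144 * (2 * (n : ℝ) + 1) ^ 9 := by ring
    calc _ = (2 * ((edgesIn (zdGraph 3) (box 3 n)).card : ℝ) / p *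
          (2 * (2 * (n : ℝ) + 1) ^ 3 * (edgesIn (zdGraph 3) (box 3 n)).card)) *
            Real.exp (-2 * (p : ℝ) ^ 2 * (1 - p) ^ 2 * t ^ 2) := by ring
      _ ≤ (144 / p * (2 * (n : ℝ) + 1) ^ 9) * Real.exp (-2 * (p : ℝ) ^ 2 * (1 - p) ^ 2 * t ^ 2) :=
          mul_le_mul_of_nonneg_right h1 he0
      _ = _ := by ring
  -- (vi) assemble
  have h1p1 : 1 - (p : ℝ) ≤ 1 := by linarith [p.2.1]
  have hsq0 : 0 ≤ Real.sqrt (2 * (edgesIn (zdGraph 3) (box 3 n)).card) := Real.sqrt_nonneg _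
  have hbr0 : 0 ≤ ((innerBoundary (zdGraph 3) (box 3 j)).card : ℝ) * (1 + (2 * (k : ℝ) + 1) ^ 3 * S) /
        (2 * (2 * (j : ℝ) + 1)) + (2 * (j : ℝ) + 1) / 2 :=
    add_nonneg (div_nonneg (mul_nonneg (Nat.cast_nonneg _) (by positivity)) (by linarith)) (by linarith)
  have hrhs0 : 0 ≤ t * (18 * Real.sqrt ((n : ℝ) ^ 3)) :=
    mul_nonneg ht (mul_nonneg (by norm_num) (Real.sqrt_nonneg _))
  have hin : t * Real.sqrt (2 * (edgesIn (zdGraph 3) (box 3 n)).card) *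
      (((innerBoundary (zdGraph 3) (box 3 j)).card : ℝ) * (1 + (2 * (k : ℝ) + 1) ^ 3 * S) /
          (2 * (2 * (j : ℝ) + 1)) + (2 * (j : ℝ) + 1) / 2) ≤
      t * (18 * Real.sqrt ((n : ℝ) ^ 3)) * (3 * j * (7 / 2 + 81 * K₂ * (k : ℝ) ^ 27 * T)) :=
    mul_le_mul (mul_le_mul_of_nonneg_left hsqE ht) hbr hbr0 hrhs0
  have hin0 : 0 ≤ t * Real.sqrt (2 * (edgesIn (zdGraph 3) (box 3 n)).card) *
      (((innerBoundary (zdGraph 3) (box 3 j)).card : ℝ) * (1 + (2 * (k : ℝ) + 1) ^ 3 * S) /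
          (2 * (2 * (j : ℝ) + 1)) + (2 * (j : ℝ) + 1) / 2) := mul_nonneg (mul_nonneg ht hsq0) hbr0
  have hmain : (1 - (p : ℝ)) * (t * Real.sqrt (2 * (edgesIn (zdGraph 3) (box 3 n)).card) *
      (((innerBoundary (zdGraph 3) (box 3 j)).card : ℝ) * (1 + (2 * (k : ℝ) + 1) ^ 3 * S) /
          (2 * (2 * (j : ℝ) + 1)) + (2 * (j : ℝ) + 1) / 2)) ≤
      t * Real.sqrt ((n : ℝ) ^ 3) * j * (189 + 4374 * K₂ * (k : ℝ) ^ 27 * T) := by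
    calc _ ≤ 1 * (t * Real.sqrt (2 * (edgesIn (zdGraph 3) (box 3 n)).card) *
          (((innerBoundary (zdGraph 3) (box 3 j)).card : ℝ) * (1 + (2 * (k : ℝ) + 1) ^ 3 * S) /
              (2 * (2 * (j : ℝ) + 1)) + (2 * (j : ℝ) + 1) / 2)) := mul_le_mul_of_nonneg_right h1p1 hin0
      _ ≤ t * (18 * Real.sqrt ((n : ℝ) ^ 3)) * (3 * j * (7 / 2 + 81 * K₂ * (k : ℝ) ^ 27 * T)) := by
          rw [one_mul]; exact hin
      _ = _ := by ring
  exact hL.trans (hcov.trans (add_le_add hmain hJ))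

end Summit.CriticalPhenomena.PercolationContinuityZ3.Theorems

end
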